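import Mathlib
import Summits.Ventures.PercRepro.TriangleCapOneTriangleA

/-!
# PercRepro — the one-triangle case, part B: the far-pair bounds per vertex class and the cross-pair count
(p3, gen 34; part 33b)

For a triangle `u v w` of a `K₄⁻`-free graph: a vertex `z` adjacent to neither `a` nor `b` of an edge `a b` has
`far z + 2 ≥ 2 (|N(a) ∖ N(z)| + |N(b) ∖ N(z)|)` (`two_mul_nb_le_far_add_two`); hence a private neighbour `z` of
`u` has `far z ≥ 2 + 2 |priv v ∖ N(z)| + 2 |priv w ∖ N(z)|` (`far_ge_of_mem_priv`), an outer vertex has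
`far z ≥ 6` (`far_ge_six_of_mem_outer`), and `u` itself is far from every ordered pair between `priv v` and
`priv w` (`far_ge_cross`).  The cross-pair count: `cross X Y + Σ_{x ∈ X} |Y ∖ N(x)| + Σ_{y ∈ Y} |X ∖ N(y)| ≥ 2|X||Y|`
for disjoint `X, Y` (`cross_add_sum_ge`).  Axioms: standard.
-/

namespace PercRepro

namespace TriangleCap

namespace C047

open Finset

variable {V : Type*} [Fintype V] [DecidableEq V]

omit [DecidableEq V] in
/-- The neighbours of `a` that are not neighbours of `z`. -/
def nb (D : SimpleGraph V) [DecidableRel D.Adj] (a z : V) : ℕ :=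
  (univ.filter (fun y => D.Adj a y ∧ ¬ D.Adj z y)).card

/-- Swapping the coordinates is a bijection between mirror classes of ordered adjacent pairs. -/
theorem card_filter_swap (D : SimpleGraph V) [DecidableRel D.Adj] (P Q : V × V → Prop)
    [DecidablePred P] [DecidablePred Q] (h : ∀ p, P p ↔ Q p.swap) :
    ((adjPairsAll D).filter P).card = ((adjPairsAll D).filter Q).card := by
  have e : (adjPairsAll D).filter Q = ((adjPairsAll D).filter P).image Prod.swap := by
    ext p
    rw [mem_image]
    constructor
    · intro hp
      refine ⟨p.swap, ?_, Prod.swap_swap p⟩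
      rw [mem_filter, mem_adjPairsAll] at hp ⊢
      rw [h, Prod.swap_swap, Prod.fst_swap, Prod.snd_swap]
      exact ⟨hp.1.symm, hp.2⟩
    · rintro ⟨q, hq, rfl⟩
      rw [mem_filter, mem_adjPairsAll] at hq ⊢
      rw [Prod.fst_swap, Prod.snd_swap]
      exact ⟨hq.1.symm, (h q).mp hq.2⟩
  rw [e, card_image_of_injective _ Prod.swap_injective]

/-- The pairs starting at `a` or `b` and ending outside `N(z)` number `nb a z + nb b z`. -/
theorem card_start_pairs (D : SimpleGraph V) [DecidableRel D.Adj] (a b z : V) (hab : a ≠ b) :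
    ((adjPairsAll D).filter (fun p => (p.1 = a ∨ p.1 = b) ∧ ¬ D.Adj z p.2)).card = nb D a z + nb D b z := by
  have e : (adjPairsAll D).filter (fun p => (p.1 = a ∨ p.1 = b) ∧ ¬ D.Adj z p.2) =
      (({a, b} : Finset V) ×ˢ univ).filter (fun p => D.Adj p.1 p.2 ∧ ¬ D.Adj z p.2) := by
    ext p
    simp only [mem_filter, mem_adjPairsAll, mem_product, mem_univ, and_true, mem_insert, mem_singleton]
    tauto
  rw [e, card_filter, sum_product, sum_pair hab]
  unfold nb
  rw [card_filter, card_filter]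

/-- **The far-pair bound from an edge `a b` missed by `z`:** `2 (nb a z + nb b z) ≤ far z + 2`. -/
theorem two_mul_nb_le_far_add_two (D : SimpleGraph V) [DecidableRel D.Adj] {a b z : V} (hab : D.Adj a b)
    (hza : ¬ D.Adj z a) (hzb : ¬ D.Adj z b) : 2 * (nb D a z + nb D b z) ≤ far D z + 2 := by
  set S₁ := (adjPairsAll D).filter (fun p => (p.1 = a ∨ p.1 = b) ∧ ¬ D.Adj z p.2) with hS₁
  set S₂ := (adjPairsAll D).filter (fun p => (p.2 = a ∨ p.2 = b) ∧ ¬ D.Adj z p.1) with hS₂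
  have h1 : S₁.card = nb D a z + nb D b z := card_start_pairs D a b z hab.ne
  have h2 : S₂.card = S₁.card := by
    rw [hS₁, hS₂]
    exact card_filter_swap D _ _ (fun p => by simp only [Prod.fst_swap, Prod.snd_swap])
  have hsub : S₁ ∪ S₂ ⊆ (adjPairsAll D).filter (fun p => ¬ D.Adj p.1 z ∧ ¬ D.Adj p.2 z) := by
    intro p hp
    rw [mem_union, hS₁, hS₂, mem_filter, mem_filter] at hp
    rw [mem_filter]
    rcases hp with ⟨hA, h, hz⟩ | ⟨hA, h, hz⟩
    · refine ⟨hA, ?_, fun h' => hz h'.symm⟩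
      rcases h with rfl | rfl
      · exact fun h' => hza h'.symm
      · exact fun h' => hzb h'.symm
    · refine ⟨hA, fun h' => hz h'.symm, ?_⟩
      rcases h with rfl | rfl
      · exact fun h' => hza h'.symm
      · exact fun h' => hzb h'.symm
  have hint : S₁ ∩ S₂ ⊆ {(a, b), (b, a)} := by
    intro p hp
    rw [mem_inter, hS₁, hS₂, mem_filter, mem_filter, mem_adjPairsAll] at hp
    obtain ⟨⟨hadj, h1, _⟩, ⟨_, h2, _⟩⟩ := hp
    simp only [mem_insert, mem_singleton, Prod.ext_iff]
    rcases h1 with h1 | h1 <;> rcases h2 with h2 | h2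
    · exact (hadj.ne (h1.trans h2.symm)).elim
    · exact Or.inl ⟨h1, h2⟩
    · exact Or.inr ⟨h1, h2⟩
    · exact (hadj.ne (h1.trans h2.symm)).elim
  have h3 := card_union_add_card_inter S₁ S₂
  have h4 := card_le_card hsub
  have h5 := le_trans (card_le_card hint) (card_le_two (a := (a, b)) (b := (b, a)))
  unfold far
  omega

/-- A private neighbour `z` of `u` sees the edge `v w` and the edges `v y`, `w y′` to the private
neighbours `y ∈ priv v`, `y′ ∈ priv w` that are not its own neighbours. -/
theorem far_ge_of_mem_priv (D : SimpleGraph V) [DecidableRel D.Adj] {u v w z : V}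
    (huv : D.Adj u v) (huw : D.Adj u w) (hvw : D.Adj v w) (hz : z ∈ priv D u v w) :
    2 + 2 * ((priv D v u w).filter (fun y => ¬ D.Adj z y)).card +
      2 * ((priv D w u v).filter (fun y => ¬ D.Adj z y)).card ≤ far D z := by
  rw [mem_priv] at hz
  obtain ⟨hzu, hzv, hzw⟩ := hz
  have h := two_mul_nb_le_far_add_two D hvw (fun h => hzv h.symm) (fun h => hzw h.symm)
  have hv : ((priv D v u w).filter (fun y => ¬ D.Adj z y)).card + 1 ≤ nb D v z := by
    unfold nb
    have hsub : insert w ((priv D v u w).filter (fun y => ¬ D.Adj z y)) ⊆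
        univ.filter (fun y => D.Adj v y ∧ ¬ D.Adj z y) := by
      intro y hy
      rw [mem_insert, mem_filter, mem_priv] at hy
      rw [mem_filter]
      refine ⟨mem_univ _, ?_⟩
      rcases hy with rfl | ⟨⟨h1, _, _⟩, h2⟩
      · exact ⟨hvw, fun h => hzw h.symm⟩
      · exact ⟨h1, h2⟩
    have hnot : w ∉ (priv D v u w).filter (fun y => ¬ D.Adj z y) := by
      rw [mem_filter, mem_priv]
      exact fun h => h.1.2.1 huw
    have := card_le_card hsub
    rw [card_insert_of_notMem hnot] at this
    omega
  have hw : ((priv D w u v).filter (fun y => ¬ D.Adj z y)).card + 1 ≤ nb D w z := by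
    unfold nb
    have hsub : insert v ((priv D w u v).filter (fun y => ¬ D.Adj z y)) ⊆
        univ.filter (fun y => D.Adj w y ∧ ¬ D.Adj z y) := by
      intro y hy
      rw [mem_insert, mem_filter, mem_priv] at hy
      rw [mem_filter]
      refine ⟨mem_univ _, ?_⟩
      rcases hy with rfl | ⟨⟨h1, _, _⟩, h2⟩
      · exact ⟨hvw.symm, fun h => hzv h.symm⟩
      · exact ⟨h1, h2⟩
    have hnot : v ∉ (priv D w u v).filter (fun y => ¬ D.Adj z y) := by
      rw [mem_filter, mem_priv]
      exact fun h => h.1.2.1 huv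
    have := card_le_card hsub
    rw [card_insert_of_notMem hnot] at this
    omega
  omega

/-- An outer vertex is far from the six ordered pairs of the triangle. -/
theorem far_ge_six_of_mem_outer (D : SimpleGraph V) [DecidableRel D.Adj] {u v w z : V}
    (huv : D.Adj u v) (huw : D.Adj u w) (hvw : D.Adj v w) (hz : z ∈ outer D u v w) : 6 ≤ far D z := by
  rw [mem_outer] at hz
  obtain ⟨hzu, hzv, hzw⟩ := hz
  have h := two_mul_nb_le_far_add_two D hvw (fun h => hzv h.symm) (fun h => hzw h.symm)
  have hv : 2 ≤ nb D v z := by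
    unfold nb
    have hsub : ({u, w} : Finset V) ⊆ univ.filter (fun y => D.Adj v y ∧ ¬ D.Adj z y) := by
      intro y hy
      rw [mem_insert, mem_singleton] at hy
      rw [mem_filter]
      rcases hy with rfl | rfl
      · exact ⟨mem_univ _, huv.symm, fun h => hzu h.symm⟩
      · exact ⟨mem_univ _, hvw, fun h => hzw h.symm⟩
    have := card_le_card hsub
    rw [card_pair huw.ne] at this
    exact this
  have hw : 2 ≤ nb D w z := by
    unfold nb
    have hsub : ({u, v} : Finset V) ⊆ univ.filter (fun y => D.Adj w y ∧ ¬ D.Adj z y) := by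
      intro y hy
      rw [mem_insert, mem_singleton] at hy
      rw [mem_filter]
      rcases hy with rfl | rfl
      · exact ⟨mem_univ _, huw.symm, fun h => hzu h.symm⟩
      · exact ⟨mem_univ _, hvw.symm, fun h => hzv h.symm⟩
    have := card_le_card hsub
    rw [card_pair huv.ne] at this
    exact this
  omega

omit [DecidableEq V] in
/-- The ordered adjacent pairs between two vertex sets (both directions). -/
def cross (D : SimpleGraph V) [DecidableRel D.Adj] (X Y : Finset V) : ℕ :=
  ((adjPairsAll D).filter (fun p => (p.1 ∈ X ∧ p.2 ∈ Y) ∨ (p.1 ∈ Y ∧ p.2 ∈ X))).card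

/-- `u` is far from every ordered pair between `priv v` and `priv w`. -/
theorem far_ge_cross (D : SimpleGraph V) [DecidableRel D.Adj] (u v w : V) :
    cross D (priv D v u w) (priv D w u v) ≤ far D u := by
  unfold cross far
  apply card_le_card
  intro p hp
  rw [mem_filter] at hp ⊢
  refine ⟨hp.1, ?_⟩
  rcases hp.2 with ⟨h1, h2⟩ | ⟨h1, h2⟩ <;> rw [mem_priv] at h1 h2
  · exact ⟨fun h => h1.2.1 h.symm, fun h => h2.2.1 h.symm⟩
  · exact ⟨fun h => h1.2.1 h.symm, fun h => h2.2.1 h.symm⟩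

/-- The ordered adjacent pairs from `X` to `Y` plus the non-adjacent ones make `|X|·|Y|`. -/
theorem card_adj_add_card_nonadj (D : SimpleGraph V) [DecidableRel D.Adj] (X Y : Finset V) :
    ((adjPairsAll D).filter (fun p => p.1 ∈ X ∧ p.2 ∈ Y)).card +
      ∑ x ∈ X, (Y.filter (fun y => ¬ D.Adj x y)).card = X.card * Y.card := by
  have e : (adjPairsAll D).filter (fun p => p.1 ∈ X ∧ p.2 ∈ Y) =
      (X ×ˢ Y).filter (fun p => D.Adj p.1 p.2) := by
    ext p
    simp only [mem_filter, mem_adjPairsAll, mem_product]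
    tauto
  have e2 : ∑ x ∈ X, (Y.filter (fun y => ¬ D.Adj x y)).card =
      ((X ×ˢ Y).filter (fun p => ¬ D.Adj p.1 p.2)).card := by
    rw [card_filter, sum_product]
    apply sum_congr rfl
    intro x _
    rw [card_filter]
  rw [e, e2, ← card_product]
  exact card_filter_add_card_filter_not (s := X ×ˢ Y) (fun p => D.Adj p.1 p.2)

/-- **The cross-pair count:** for disjoint `X, Y`,
`cross X Y + Σ_{x ∈ X} |Y ∖ N(x)| + Σ_{y ∈ Y} |X ∖ N(y)| ≥ 2 |X| |Y|`. -/
theorem cross_add_sum_ge (D : SimpleGraph V) [DecidableRel D.Adj] (X Y : Finset V) (hXY : Disjoint X Y) :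
    2 * (X.card * Y.card) ≤ cross D X Y + ∑ x ∈ X, (Y.filter (fun y => ¬ D.Adj x y)).card +
      ∑ y ∈ Y, (X.filter (fun x => ¬ D.Adj y x)).card := by
  have h1 := card_adj_add_card_nonadj D X Y
  have h2 := card_adj_add_card_nonadj D Y X
  have h3 : ((adjPairsAll D).filter (fun p => p.1 ∈ X ∧ p.2 ∈ Y)).card +
      ((adjPairsAll D).filter (fun p => p.1 ∈ Y ∧ p.2 ∈ X)).card ≤ cross D X Y := by
    unfold cross
    rw [← card_union_of_disjoint]
    · apply card_le_card
      intro p hp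
      rw [mem_union, mem_filter, mem_filter] at hp
      rw [mem_filter]
      rcases hp with ⟨hA, h⟩ | ⟨hA, h⟩
      · exact ⟨hA, Or.inl h⟩
      · exact ⟨hA, Or.inr h⟩
    · rw [disjoint_filter]
      intro p _ h1 h2
      exact disjoint_left.mp hXY h1.1 h2.1
  have : Y.card * X.card = X.card * Y.card := mul_comm _ _
  omega

end C047

end TriangleCap

end PercRepro
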